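import Summits.Langlands.Langlands.Theses.EisensteinGelfandKirillov
import Literature.NumberTheory.Automorphic.PairLFunctionPolesRepData
import Summits.Langlands.Langlands.Theorems.EisensteinGelfandKirillovSectorComplementSeam

/-!
# Route EisensteinGelfandKirillov — `SectorComplement` (stmt-Langlands-18275): what the frame item IS,
# given the two Arthur–Clozel facts (`--supports` certificate; no definitions)

`SectorComplement := ReducibleCrystallineModular → Langlands` is the route's declared COMPLEMENT OF THE
SECTOR (D-0027 §2.2 frame item).  The line `Sketch-18275-r1-k1` closes it modulo six registered leaves
(W, B_w off the Eisenstein region, LGC∀, JS (2.2), JS (2.3), RD); four of them (W, B_w, LGC∀, RD) are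
conjuncts of the statement item stmt-Langlands-17925 `ReciprocityUpToIrreducibilityR` — written below by
its TEXT, verbatim:

  `E := ∀ F, Nonempty (ReciprocityData F) ∧ ∀ Rec n, 0 < n → ∀ hcpt, (A′) ∧ (B)`

(the re-typed summit with clause (A) weakened by dropping irreducibility and uniqueness) — and the other
two are the Literature facts `JacquetShalika1981_partialPairL_boundary_repData` (item stmt-Langlands-13622)
and `JacquetShalika1981_partialPairL_pole_repData` (item stmt-Langlands-19093).  Kernel-checked here:

* `eisensteinGelfandKirillov_reciprocityRText_of_langlands` — `Langlands → E` (E is INSIDE the summit);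
* `eisensteinGelfandKirillov_langlands_iff_reciprocityRText_of_JS` — under (2.2) ∧ (2.3), `Langlands ↔ E`
  (← is the landed `∀ 𝓡` seam `SectorComplementSeam.langlands_of_reciprocityUpToIrreducibility_forall_text_of_JS`,
  p147356, fed with the two conjuncts of E);
* `eisensteinGelfandKirillov_sectorComplement_iff_reciprocityRText_of_JS` — under (2.2) ∧ (2.3),
  `SectorComplement ↔ (ReducibleCrystallineModular → E)` (registered sub-goal of the item, arrow form):
  given the two Arthur–Clozel facts, the frame item IS "the sector theorem implies reciprocity up to
  irreducibility for every Henniart-normalised datum" — i.e. it is blocked on stmt-Langlands-17925;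
* `eisensteinGelfandKirillov_sectorComplement_of_reciprocityRText_of_JS` — E → (2.2) → (2.3) →
  `SectorComplement` (the frame item from the three items; `X` idle, as for every frame item).

Companion of `EisensteinGelfandKirillovSectorComplementOfReciprocityR.lean` (same identities with E BY
NAME, `Theses.IrreducibilityBySelfDuality.ReciprocityUpToIrreducibilityR`); this file imports no foreign
route file.  Nothing here asserts the item, the target, E, the Jacquet–Shalika facts or the summit.
-/

noncomputable section

set_option linter.dupNamespace false -- project-wide option; `Summit.Langlands.Langlands` is the mandated namespace

namespace Summit.Langlands.Langlands.Theorems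

/-- **Reciprocity up to irreducibility for every datum (text of stmt-Langlands-17925) is inside the
summit**: `Langlands → E` — keep the non-vacuity conjunct and clause (B) verbatim; in clause (A) forget
irreducibility and uniqueness up to conjugacy. [cite: BuzzardGeeLMS2014, Conj. 3.2.1 and Conj. 3.2.2] -/
theorem eisensteinGelfandKirillov_reciprocityRText_of_langlands (hL : _root_.Langlands) :
    ∀ (F : Type) [Field F] [NumberField F], Nonempty (Summit.Langlands.ReciprocityData F) ∧ ∀ (Rec : Summit.Langlands.ReciprocityData F) (n : ℕ), 0 < n → ∀ hcpt : Literature.NumberTheory.Automorphic.isCompact_glFiniteIntegralLevel n F, (∀ π : Literature.NumberTheory.Automorphic.CuspidalAutomorphicRepData n F hcpt, π.1.IsLAlgebraic → ∀ (ℓ : ℕ) [Fact ℓ.Prime] (ι : PadicAlgCl ℓ ≃+* ℂ), ∃ ρ : Literature.NumberTheory.GaloisRepresentations.FramedGaloisRep F (PadicAlgCl ℓ) n, Summit.Langlands.IsGeometricFramed Rec ρ ∧ Summit.Langlands.Corresponds Rec ι π.1 ρ) ∧ Summit.Langlands.GaloisToAutomorphic n Rec hcpt := by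
  intro F _ _
  obtain ⟨hne, hall⟩ := hL F
  refine ⟨hne, fun Rec n hn hcpt => ?_⟩
  obtain ⟨hA, hB⟩ := hall Rec n hn hcpt
  refine ⟨fun π hπ ℓ _ ι => ?_, hB⟩
  obtain ⟨ρ, -, hgeo, hcorr, -⟩ := hA π hπ ℓ ι
  exact ⟨ρ, hgeo, hcorr⟩

/-- **Under the two Arthur–Clozel facts the summit IS reciprocity up to irreducibility for every
datum**: `Langlands ↔ E` (E = text of stmt-Langlands-17925).  `→` forgets; `←` is the landed `∀ 𝓡` seam
(isobaric bootstrap from Jacquet–Shalika (2.2)/(2.3), then Chebotarev + Brauer–Nesbitt for uniqueness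
up to conjugacy). [cite: ArthurClozelAMS120, Ch. 3 §2 (2.2)–(2.3)] [cite: BuzzardGeeLMS2014, Conj. 3.2.1 and Conj. 3.2.2] -/
theorem eisensteinGelfandKirillov_langlands_iff_reciprocityRText_of_JS
    (h22 : Literature.NumberTheory.Automorphic.JacquetShalika1981_partialPairL_boundary_repData)
    (h23 : Literature.NumberTheory.Automorphic.JacquetShalika1981_partialPairL_pole_repData) :
    _root_.Langlands ↔ ∀ (F : Type) [Field F] [NumberField F], Nonempty (Summit.Langlands.ReciprocityData F) ∧ ∀ (Rec : Summit.Langlands.ReciprocityData F) (n : ℕ), 0 < n → ∀ hcpt : Literature.NumberTheory.Automorphic.isCompact_glFiniteIntegralLevel n F, (∀ π : Literature.NumberTheory.Automorphic.CuspidalAutomorphicRepData n F hcpt, π.1.IsLAlgebraic → ∀ (ℓ : ℕ) [Fact ℓ.Prime] (ι : PadicAlgCl ℓ ≃+* ℂ), ∃ ρ : Literature.NumberTheory.GaloisRepresentations.FramedGaloisRep F (PadicAlgCl ℓ) n, Summit.Langlands.IsGeometricFramed Rec ρ ∧ Summit.Langlands.Corresponds Rec ι π.1 ρ) ∧ Summit.Langlands.GaloisToAutomorphic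 n Rec hcpt :=
  ⟨eisensteinGelfandKirillov_reciprocityRText_of_langlands, fun hE =>
    SectorComplementSeam.langlands_of_reciprocityUpToIrreducibility_forall_text_of_JS h22 h23
      (fun F _ _ => (hE F).1) (fun F _ _ Rec n hn hcpt => (hE F).2 Rec n hn hcpt)⟩

/-- **What the frame item is, given the two Arthur–Clozel facts** (registered sub-goal of
stmt-Langlands-18275, arrow form, fully qualified): (2.2) → (2.3) →
(`SectorComplement ↔ (ReducibleCrystallineModular → E)`), E = text of stmt-Langlands-17925 — the sector
theorem must imply reciprocity up to irreducibility for every Henniart-normalised datum, no more and no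
less; in particular the item is blocked on stmt-Langlands-17925. [cite: BuzzardGeeLMS2014, Conj. 3.2.2] -/
theorem eisensteinGelfandKirillov_sectorComplement_iff_reciprocityRText_of_JS : Literature.NumberTheory.Automorphic.JacquetShalika1981_partialPairL_boundary_repData → Literature.NumberTheory.Automorphic.JacquetShalika1981_partialPairL_pole_repData → (Summit.Langlands.Langlands.Theses.EisensteinGelfandKirillov.SectorComplement ↔ (Summit.Langlands.Langlands.Theses.EisensteinGelfandKirillov.ReducibleCrystallineModular → ∀ (F : Type) [Field F] [NumberField F], Nonempty (Summit.Langlands.ReciprocityData F) ∧ ∀ (Rec : Summit.Langlands.ReciprocityData F) (n : ℕ), 0 < n → ∀ hcpt : Literature.NumberTheory.Automorphic.isCompact_glFiniteIntegralLevel n F, (∀ π : Literature.NumberTheory.Automorphic.CuspidalAutomorphicRepData n F hcpt, π.1.IsLAlgebraic → ∀ (ℓ : ℕ) [Fact ℓ.Prime] (ι : PadicAlgCl ℓ ≃+* ℂ), ∃ ρ : Literature.NumberTheory.GaloisRepresentations.FramedGaloisRep F (PadicAlgCl ℓ) n, Summit.Langlands.IsGeometricFramed Rec ρ ∧ Summit.Langlands.Corresponds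 Rec ι π.1 ρ) ∧ Summit.Langlands.GaloisToAutomorphic n Rec hcpt)) := by
  intro h22 h23
  refine ⟨fun hC hX => eisensteinGelfandKirillov_reciprocityRText_of_langlands (hC hX), fun h hX => ?_⟩
  exact (eisensteinGelfandKirillov_langlands_iff_reciprocityRText_of_JS h22 h23).2 (h hX)

/-- **The frame item from the three existing items** (E by text, the two Arthur–Clozel facts by their
Literature names): E → (2.2) → (2.3) → `SectorComplement`; the route target is not used.
[cite: BuzzardGeeLMS2014, Conj. 3.2.2] -/
theorem eisensteinGelfandKirillov_sectorComplement_of_reciprocityRText_of_JS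
    (hE : ∀ (F : Type) [Field F] [NumberField F], Nonempty (Summit.Langlands.ReciprocityData F) ∧ ∀ (Rec : Summit.Langlands.ReciprocityData F) (n : ℕ), 0 < n → ∀ hcpt : Literature.NumberTheory.Automorphic.isCompact_glFiniteIntegralLevel n F, (∀ π : Literature.NumberTheory.Automorphic.CuspidalAutomorphicRepData n F hcpt, π.1.IsLAlgebraic → ∀ (ℓ : ℕ) [Fact ℓ.Prime] (ι : PadicAlgCl ℓ ≃+* ℂ), ∃ ρ : Literature.NumberTheory.GaloisRepresentations.FramedGaloisRep F (PadicAlgCl ℓ) n, Summit.Langlands.IsGeometricFramed Rec ρ ∧ Summit.Langlands.Corresponds Rec ι π.1 ρ) ∧ Summit.Langlands.GaloisToAutomorphic n Rec hcpt)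
    (h22 : Literature.NumberTheory.Automorphic.JacquetShalika1981_partialPairL_boundary_repData)
    (h23 : Literature.NumberTheory.Automorphic.JacquetShalika1981_partialPairL_pole_repData) :
    Summit.Langlands.Langlands.Theses.EisensteinGelfandKirillov.SectorComplement :=
  (eisensteinGelfandKirillov_sectorComplement_iff_reciprocityRText_of_JS h22 h23).2 fun _ => hE

end Summit.Langlands.Langlands.Theorems

end
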